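import Mathlib
import Summits.ValiantsHypothesis.ValiantsHypothesis.Theses.RigidityForcesSymmetry

/-!
# SEPARATED-PROFILE ELIMINATION and the 3-slot CAPTURE INEQUALITY  (val-idea-19 g8, crux idea #8 `separated-capture`
on stmt-ValiantsHypothesis-24813 `LaplaceOptimalFive`)

A split profile of `Fin 5` is SEPARATED along `Z | Zᶜ` when every short side lies inside `Z` or inside `Zᶜ`.
For `Z = {3,4}` these are exactly the profiles K₃ ⊔ K₂ = {01, 02, 12, 34} (the k = 4 frontier of the K1 HARD list,
crit-3 g5 CUSTODY note §4) and its sub-supports.  For such a profile the configuration space splits as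
`L'(U) = U₃₄ ⊗ V^{⊗3} + V^{⊗2} ⊗ L₃(U₀₁,U₀₂,U₁₂)` and finite-dimensional duality gives

  HONEST decomposability with spans U  ⟺  every OBLIGATION tensor `T_μ := P₅ ⌞ μ` (μ a 5 × 5 matrix on the leaf
  slots annihilating the leaf's short span) is CAPTURED: `T_μ ∈ L₃(U₀₁,U₀₂,U₁₂)`.

Only the symmetric zero-diagonal part of `U₃₄` matters (leaf terms are WLOG on-shell and side-symmetric), the obligation
space has dimension `10 − dim(U₃₄ ∩ Sym₀) ≥ 10 − m₃₄`, and therefore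

  `LaplaceOptimalFive` on all {3,4}-separated pair profiles (both sectors S2′/S3′ of LINE `shallow_collision`, any
  multiplicities, off-shell allowed)  ⟺  `CaptureIneq` below: a triangle configuration of total dimension
  m = m₀₁ + m₀₂ + m₁₂ captures at most m independent symmetric obligations.

A violating triangle configuration would be an HONEST decomposition of P₅ of weight ≤ 108 (`stub_violation_refutes`).
Ambient dimension of the reduced problem: 125 (not 3125).  PROVED here (r3): `stub_obligation_captured` (obligations are captured),
`stub_separated_of_capture` (CaptureIneq ⇒ the crux on every {3,4}-separated pair profile), `violation_refutes`, `separated_of_laplaceOptimalFive`;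
NO `sorry` remains (r4): the converse construction `stub_violation_honest` is proved too, so `CaptureIneq` ⟺ the crux on {3,4}-separated pair profiles is a kernel EQUIVALENCE and `violation_refutes` an unconditional implication `¬CaptureIneq → ¬LaplaceOptimalFive` (names `stub_*` kept for cross-reference).  VP ≠ VNP is NOT proved; 24813 is OPEN·CONTESTED 72/120.
r5 (memo 2 `SeparatedCaptureSubpermanent.md`): the Boolean-algebra frame `cap = 10 − dim μ(L₃^⊥)`; `tripleEval` / `tripleEval_L3_eq_zero` /
`witness_annihilates` (a pairwise-isotropic triple kills every captured obligation — rank-one / sub-permanent witnesses, sorry-free), `per3`, and the OPEN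
Prop `RankOneWitness45` (the (4,5)/(5,4) residue as one witness).  memo 1 §3's «cap⁺ ≤ m» is WITHDRAWN (false on generic (5,4)); nothing here closes the crux.
r6 (memo 2 r2 §9): `obl` / `oblL` (obligation coordinates of a triple), `tripleEval_contractZ` (the rank-one functional on `contractZ ν` in leaf
coordinates) and `finrank_le_nine_of_witness`: ONE pairwise-isotropic triple with a non-zero obligation coordinate forces `finrank W ≤ 9` for every captured
symmetric zero-diagonal `W` — the finrank form of the W-lemma, so a proof of `RankOneWitness45` feeds `CaptureIneq` at (4,5)/(5,4) directly; and
`finrank_le_eight_of_two_witnesses` (two triples with a non-zero 2 × 2 minor of obligation coordinates ⇒ `finrank W ≤ 8`: the (4,4) interface).  Sorry-free; std axioms.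
r6.2 (memo 2 r3 §10): `witness_of_vanishing_columns` — the explicit witness `(α, x_s+x_t, x_s+x_t)` whenever the columns `s,t` of all forms vanish at an `α` with a
non-zero letter outside `{s,t}` (the kernel of the leaf closures L7 / L9 and the Π-quadric Λ-argument).  Sorry-free; std axioms.
-/

namespace Summit.ValiantsHypothesis.ValiantsHypothesis.Cruxes.LaplaceOptimalFive.SeparatedCapture

open Finset

/-! ### Vocabulary copied VERBATIM from `Lines/shallow_collision.lean` (same names, same bodies; crux workfiles are not
importable on the farm snapshot). -/

/-- The two cylinder conditions of `LaplaceOptimal 5` for a term system `(S, u, w)`. -/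
def Cylindrical {N : ℕ} (S : Fin N → Finset (Fin 5)) (u w : Fin N → (Fin 5 → Fin 5) → ℂ) : Prop :=
  (∀ t, ∀ v v' : Fin 5 → Fin 5, (∀ i ∈ S t, v i = v' i) → u t v = u t v') ∧
  (∀ t, ∀ v v' : Fin 5 → Fin 5, (∀ i, i ∉ S t → v i = v' i) → w t v = w t v')

/-- Laplace weight of the profile. -/
def weight {N : ℕ} (T : Finset (Fin N)) (S : Fin N → Finset (Fin 5)) : ℕ :=
  ∑ t ∈ T, (S t).card.factorial * (5 - (S t).card).factorial

/-! ### New objects -/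

/-- The 5 × 5 permutation pattern `P₅ = [v injective]` (the right-hand side of the crux). -/
def perm5 (v : Fin 5 → Fin 5) : ℂ := if Function.Injective v then 1 else 0

/-- The word with letters `p q r` on the triangle slots `0 1 2` and `s t` on the leaf slots `3 4`. -/
def word (p q r s t : Fin 5) : Fin 5 → Fin 5 := ![p, q, r, s, t]

/-- OBLIGATION TENSOR `T_μ := P₅ ⌞ μ`: contraction of `P₅` against a leaf matrix `μ` on slots `{3,4}`.  On injective
triples `(p,q,r)` it equals `μ s t + μ t s` with `{s,t} = {p,q,r}ᶜ`; it vanishes on non-injective triples.  Linear in `μ`,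
blind to the antisymmetric and diagonal parts of `μ`. -/
def contractZ (μ : Fin 5 → Fin 5 → ℂ) : Fin 5 → Fin 5 → Fin 5 → ℂ :=
  fun p q r => ∑ s : Fin 5, ∑ t : Fin 5, μ s t * perm5 (word p q r s t)

/-- TRIANGLE CONFIGURATION SPACE `L₃(U₀₁,U₀₂,U₁₂) = U₀₁ ⊗ V₂ + U₀₂ ⊗ V₁ + U₁₂ ⊗ V₀ ⊂ (ℂ⁵)^{⊗3}` (3-tensors written as
functions `p q r ↦ T p q r` on slots `0 1 2`). -/
def L3 (U01 U02 U12 : Submodule ℂ (Fin 5 → Fin 5 → ℂ)) : Submodule ℂ (Fin 5 → Fin 5 → Fin 5 → ℂ) :=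
  Submodule.span ℂ
    ({T | ∃ u ∈ U01, ∃ y : Fin 5 → ℂ, T = fun p q r => u p q * y r} ∪
     {T | ∃ u ∈ U02, ∃ y : Fin 5 → ℂ, T = fun p q r => u p r * y q} ∪
     {T | ∃ u ∈ U12, ∃ y : Fin 5 → ℂ, T = fun p q r => u q r * y p})

/-- THE 3-SLOT CAPTURE INEQUALITY (pair version).  `W` ranges over spaces of symmetric zero-diagonal leaf matrices
(≅ subspaces of ℂ¹⁰ = functions on 3-subsets, via complement); if every obligation `T_μ, μ ∈ W` is captured by the
triangle configuration then `dim W ≤ m₀₁ + m₀₂ + m₁₂`.  Tight for the two Laplace configurations (all ten pair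
indicators on one direction; cf. the docstring table in the card), NOT unit-incremental (one added form can raise the
captured dimension by 3), so any proof is global.  Equivalent to `LaplaceOptimalFive` on {3,4}-separated pair profiles
(`stub_separated_of_capture` + `stub_violation_refutes`). -/
def CaptureIneq : Prop :=
  ∀ (U01 U02 U12 W : Submodule ℂ (Fin 5 → Fin 5 → ℂ)),
    (∀ μ ∈ W, ∀ s t : Fin 5, μ s t = μ t s) → (∀ μ ∈ W, ∀ s : Fin 5, μ s s = 0) →
    (∀ μ ∈ W, contractZ μ ∈ L3 U01 U02 U12) →
    Module.finrank ℂ W ≤ Module.finrank ℂ U01 + Module.finrank ℂ U02 + Module.finrank ℂ U12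

/-- Short factor of a term as a 5 × 5 matrix on the slot pair `(a, b)` (filler letter `0` elsewhere; by cylindricity the
filler is irrelevant). -/
def short2 (f : (Fin 5 → Fin 5) → ℂ) (a b : Fin 5) : Fin 5 → Fin 5 → ℂ :=
  fun p q => f (Function.update (Function.update (fun _ => (0 : Fin 5)) a p) b q)

/-- {3,4}-SEPARATED PAIR PROFILE, normalised so that `S t` is the 2-element (short, `u`-) side: the triangle cuts
`01, 02, 12` and the leaf cut `34`.  (A term filed with `S t = {0,1,2}` etc. is the same cut with `u, w` swapped.) -/
def SepProfile34 {N : ℕ} (T : Finset (Fin N)) (S : Fin N → Finset (Fin 5)) : Prop :=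
  ∀ t ∈ T, S t = ({0, 1} : Finset (Fin 5)) ∨ S t = ({0, 2} : Finset (Fin 5)) ∨
    S t = ({1, 2} : Finset (Fin 5)) ∨ S t = ({3, 4} : Finset (Fin 5))

/-- Span of the short factors of the terms on the cut with short side `{a, b}`. -/
def shortSpan {N : ℕ} (T : Finset (Fin N)) (S : Fin N → Finset (Fin 5)) (u : Fin N → (Fin 5 → Fin 5) → ℂ)
    (a b : Fin 5) : Submodule ℂ (Fin 5 → Fin 5 → ℂ) :=
  Submodule.span ℂ ((fun t => short2 (u t) a b) '' {t : Fin N | t ∈ T ∧ S t = ({a, b} : Finset (Fin 5))})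

/-! ### The first lemma (PROVED): obligations are captured.
Contract the exactness identity against a leaf matrix `μ` annihilating every leaf short factor: the leaf terms drop out,
each triangle term `u_t ⊗ w_t` contributes `u_t ⊗ (w_t ⌞ μ) ∈ U_ab ⊗ V_c`.  (Name kept `stub_…` for the card's cross-references; it carries no
`sorry`.) -/
set_option maxHeartbeats 1600000 in
theorem stub_obligation_captured :
    ∀ (N : ℕ) (T : Finset (Fin N)) (S : Fin N → Finset (Fin 5)) (u w : Fin N → (Fin 5 → Fin 5) → ℂ),
      Cylindrical S u w → (∀ v : Fin 5 → Fin 5, (∑ t ∈ T, u t v * w t v) = perm5 v) → SepProfile34 T S →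
      ∀ μ : Fin 5 → Fin 5 → ℂ,
        (∀ t ∈ T, S t = ({3, 4} : Finset (Fin 5)) → (∑ s : Fin 5, ∑ s' : Fin 5, μ s s' * short2 (u t) 3 4 s s') = 0) →
        contractZ μ ∈ L3 (shortSpan T S u 0 1) (shortSpan T S u 0 2) (shortSpan T S u 1 2) := by
  intro N T S u w hc hex hsep μ hμ
  classical
  -- short factors through `short2` (cylindricity of `u`)
  have hu01 : ∀ t, S t = ({0, 1} : Finset (Fin 5)) → ∀ p q r s t' : Fin 5,
      u t (word p q r s t') = short2 (u t) 0 1 p q := by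
    intro t hS p q r s t'
    apply hc.1 t
    intro i hi
    rw [hS] at hi
    simp only [Finset.mem_insert, Finset.mem_singleton] at hi
    rcases hi with rfl | rfl <;> simp [word, Function.update_apply]
  have hu02 : ∀ t, S t = ({0, 2} : Finset (Fin 5)) → ∀ p q r s t' : Fin 5,
      u t (word p q r s t') = short2 (u t) 0 2 p r := by
    intro t hS p q r s t'
    apply hc.1 t
    intro i hi
    rw [hS] at hi
    simp only [Finset.mem_insert, Finset.mem_singleton] at hi
    rcases hi with rfl | rfl <;> simp [word, Function.update_apply]
  have hu12 : ∀ t, S t = ({1, 2} : Finset (Fin 5)) → ∀ p q r s t' : Fin 5,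
      u t (word p q r s t') = short2 (u t) 1 2 q r := by
    intro t hS p q r s t'
    apply hc.1 t
    intro i hi
    rw [hS] at hi
    simp only [Finset.mem_insert, Finset.mem_singleton] at hi
    rcases hi with rfl | rfl <;> simp [word, Function.update_apply]
  have hu34 : ∀ t, S t = ({3, 4} : Finset (Fin 5)) → ∀ p q r s t' : Fin 5,
      u t (word p q r s t') = short2 (u t) 3 4 s t' := by
    intro t hS p q r s t'
    apply hc.1 t
    intro i hi
    rw [hS] at hi
    simp only [Finset.mem_insert, Finset.mem_singleton] at hi
    rcases hi with rfl | rfl <;> simp [word, Function.update_apply]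
  -- long factors forget the short slots (cylindricity of `w`)
  have hw01 : ∀ t, S t = ({0, 1} : Finset (Fin 5)) → ∀ p q r s t' : Fin 5,
      w t (word p q r s t') = w t (word 0 0 r s t') := by
    intro t hS p q r s t'
    apply hc.2 t
    intro i hi
    rw [hS] at hi
    fin_cases i <;> simp [word] at hi ⊢
  have hw02 : ∀ t, S t = ({0, 2} : Finset (Fin 5)) → ∀ p q r s t' : Fin 5,
      w t (word p q r s t') = w t (word 0 q 0 s t') := by
    intro t hS p q r s t'
    apply hc.2 t
    intro i hi
    rw [hS] at hi
    fin_cases i <;> simp [word] at hi ⊢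
  have hw12 : ∀ t, S t = ({1, 2} : Finset (Fin 5)) → ∀ p q r s t' : Fin 5,
      w t (word p q r s t') = w t (word p 0 0 s t') := by
    intro t hS p q r s t'
    apply hc.2 t
    intro i hi
    rw [hS] at hi
    fin_cases i <;> simp [word] at hi ⊢
  have hw34 : ∀ t, S t = ({3, 4} : Finset (Fin 5)) → ∀ p q r s t' : Fin 5,
      w t (word p q r s t') = w t (word p q r 0 0) := by
    intro t hS p q r s t'
    apply hc.2 t
    intro i hi
    rw [hS] at hi
    fin_cases i <;> simp [word] at hi ⊢
  -- the obligation tensor is the sum of the per-term contractions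
  have key : contractZ μ = ∑ t ∈ T,
      (fun p q r => ∑ s : Fin 5, ∑ t' : Fin 5, μ s t' * (u t (word p q r s t') * w t (word p q r s t'))) := by
    funext p q r
    simp only [Finset.sum_apply, contractZ, ← hex, Finset.mul_sum]
    symm
    rw [Finset.sum_comm]
    refine Finset.sum_congr rfl (fun s _ => ?_)
    rw [Finset.sum_comm]
  rw [key]
  refine Submodule.sum_mem _ (fun t ht => ?_)
  rcases hsep t ht with h01 | h02 | h12 | h34
  · -- cut 01 | 234 : contributes `short2 (u t) 0 1 ⊗ (w t ⌞ μ)` on slots (0,1) × 2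
    have hmem : short2 (u t) 0 1 ∈ shortSpan T S u 0 1 :=
      Submodule.subset_span ⟨t, ⟨ht, h01⟩, rfl⟩
    have hF : (fun p q r => ∑ s : Fin 5, ∑ t' : Fin 5, μ s t' * (u t (word p q r s t') * w t (word p q r s t')))
        = fun p q r => short2 (u t) 0 1 p q * (∑ s : Fin 5, ∑ t' : Fin 5, μ s t' * w t (word 0 0 r s t')) := by
      funext p q r
      rw [Finset.mul_sum]
      refine Finset.sum_congr rfl (fun s _ => ?_)
      rw [Finset.mul_sum]
      refine Finset.sum_congr rfl (fun t' _ => ?_)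
      rw [hu01 t h01 p q r s t', hw01 t h01 p q r s t']
      ring
    rw [hF]
    apply Submodule.subset_span
    simp only [Set.mem_union, Set.mem_setOf_eq]
    exact Or.inl (Or.inl ⟨short2 (u t) 0 1, hmem, _, rfl⟩)
  · -- cut 02 | 134
    have hmem : short2 (u t) 0 2 ∈ shortSpan T S u 0 2 :=
      Submodule.subset_span ⟨t, ⟨ht, h02⟩, rfl⟩
    have hF : (fun p q r => ∑ s : Fin 5, ∑ t' : Fin 5, μ s t' * (u t (word p q r s t') * w t (word p q r s t')))
        = fun p q r => short2 (u t) 0 2 p r * (∑ s : Fin 5, ∑ t' : Fin 5, μ s t' * w t (word 0 q 0 s t')) := by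
      funext p q r
      rw [Finset.mul_sum]
      refine Finset.sum_congr rfl (fun s _ => ?_)
      rw [Finset.mul_sum]
      refine Finset.sum_congr rfl (fun t' _ => ?_)
      rw [hu02 t h02 p q r s t', hw02 t h02 p q r s t']
      ring
    rw [hF]
    apply Submodule.subset_span
    simp only [Set.mem_union, Set.mem_setOf_eq]
    exact Or.inl (Or.inr ⟨short2 (u t) 0 2, hmem, _, rfl⟩)
  · -- cut 12 | 034
    have hmem : short2 (u t) 1 2 ∈ shortSpan T S u 1 2 :=
      Submodule.subset_span ⟨t, ⟨ht, h12⟩, rfl⟩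
    have hF : (fun p q r => ∑ s : Fin 5, ∑ t' : Fin 5, μ s t' * (u t (word p q r s t') * w t (word p q r s t')))
        = fun p q r => short2 (u t) 1 2 q r * (∑ s : Fin 5, ∑ t' : Fin 5, μ s t' * w t (word p 0 0 s t')) := by
      funext p q r
      rw [Finset.mul_sum]
      refine Finset.sum_congr rfl (fun s _ => ?_)
      rw [Finset.mul_sum]
      refine Finset.sum_congr rfl (fun t' _ => ?_)
      rw [hu12 t h12 p q r s t', hw12 t h12 p q r s t']
      ring
    rw [hF]
    apply Submodule.subset_span
    simp only [Set.mem_union, Set.mem_setOf_eq]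
    exact Or.inr ⟨short2 (u t) 1 2, hmem, _, rfl⟩
  · -- leaf cut 34 | 012 : killed by `hμ`
    have hF : (fun p q r => ∑ s : Fin 5, ∑ t' : Fin 5, μ s t' * (u t (word p q r s t') * w t (word p q r s t')))
        = 0 := by
      funext p q r
      simp only [Pi.zero_apply]
      have : ∀ s t' : Fin 5, μ s t' * (u t (word p q r s t') * w t (word p q r s t'))
          = (μ s t' * short2 (u t) 3 4 s t') * w t (word p q r 0 0) := by
        intro s t'
        rw [hu34 t h34 p q r s t', hw34 t h34 p q r s t']
        ring
      simp only [this, ← Finset.sum_mul, hμ t ht h34, zero_mul]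
    rw [hF]
    exact Submodule.zero_mem _

/-! ### The reduction (finite-dimensional duality).  (⟹) `stub_separated_of_capture` is PROVED (rank–nullity on the ℂ¹⁰ chart of `Sym₀`,
`CaptureIneq`, `finrank_span_finset_le_card`, counting); only the converse construction `stub_violation_honest` is open. -/

set_option maxHeartbeats 1600000 in
/-- CAPTURE ⇒ the crux on every {3,4}-separated pair profile (both sectors, any multiplicities, off-shell allowed):
the symmetric zero-diagonal matrices annihilating the leaf span form a space `W` of dimension `≥ 10 − n₃₄`, all captured
by `stub_obligation_captured`; `CaptureIneq` gives `10 − n₃₄ ≤ m₀₁ + m₀₂ + m₁₂ ≤ n₀₁ + n₀₂ + n₁₂`, and `weight = 12·|T| ≥ 120`. -/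
theorem stub_separated_of_capture :
    CaptureIneq →
    ∀ (N : ℕ) (T : Finset (Fin N)) (S : Fin N → Finset (Fin 5)) (u w : Fin N → (Fin 5 → Fin 5) → ℂ),
      Cylindrical S u w → (∀ v : Fin 5 → Fin 5, (∑ t ∈ T, u t v * w t v) = perm5 v) → SepProfile34 T S →
      Nat.factorial 5 ≤ weight T S := by
  intro hcap N T S u w hc hex hsep
  classical
  /- (1) the profile is made of pair cuts: weight = 12·|T| and the four cut classes are disjoint in T -/
  have hweight : weight T S = 12 * T.card := by
    unfold weight
    rw [Finset.sum_congr rfl (g := fun _ => 12) ?_]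
    · simp [mul_comm]
    · intro t ht
      rcases hsep t ht with h | h | h | h <;> rw [h] <;> decide
  have hcount :
      (T.filter (fun t => S t = ({0, 1} : Finset (Fin 5)))).card
        + (T.filter (fun t => S t = ({0, 2} : Finset (Fin 5)))).card
        + (T.filter (fun t => S t = ({1, 2} : Finset (Fin 5)))).card
        + (T.filter (fun t => S t = ({3, 4} : Finset (Fin 5)))).card ≤ T.card := by
    rw [Finset.card_filter, Finset.card_filter, Finset.card_filter, Finset.card_filter,
      ← Finset.sum_add_distrib, ← Finset.sum_add_distrib, ← Finset.sum_add_distrib, Finset.card_eq_sum_ones T]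
    apply Finset.sum_le_sum
    intro t ht
    rcases hsep t ht with h | h | h | h <;> rw [h] <;> decide
  /- (2) spans are at most as big as the number of terms on the cut -/
  have hm : ∀ a b : Fin 5, Module.finrank ℂ (shortSpan T S u a b)
      ≤ (T.filter (fun t => S t = ({a, b} : Finset (Fin 5)))).card := by
    intro a b
    have hset : ((fun t => short2 (u t) a b) '' {t : Fin N | t ∈ T ∧ S t = ({a, b} : Finset (Fin 5))})
        = (((T.filter (fun t => S t = ({a, b} : Finset (Fin 5)))).image (fun t => short2 (u t) a b) :
            Finset (Fin 5 → Fin 5 → ℂ)) : Set (Fin 5 → Fin 5 → ℂ)) := by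
      ext x
      simp
    unfold shortSpan
    rw [hset]
    exact (finrank_span_finset_le_card _).trans Finset.card_image_le
  /- (3) coordinates for the symmetric zero-diagonal leaf matrices: an injective linear chart from ℂ^{10} -/
  let P := {x : Fin 5 × Fin 5 // x.1 < x.2}
  have hP : Fintype.card P = 10 := by decide
  let LsymFun : (P → ℂ) → (Fin 5 → Fin 5 → ℂ) := fun c s t =>
    if h : s < t then c ⟨(s, t), h⟩ else if h' : t < s then c ⟨(t, s), h'⟩ else 0
  let Lsym : (P → ℂ) →ₗ[ℂ] (Fin 5 → Fin 5 → ℂ) :=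
    { toFun := LsymFun
      map_add' := by
        intro c c'
        funext s t
        simp only [LsymFun, Pi.add_apply]
        split_ifs <;> simp
      map_smul' := by
        intro r c
        funext s t
        simp only [LsymFun, Pi.smul_apply, smul_eq_mul, RingHom.id_apply]
        split_ifs <;> simp }
  have hLsym_apply : ∀ c s t, Lsym c s t = LsymFun c s t := fun _ _ _ => rfl
  have hinj : Function.Injective Lsym := by
    intro c c' h
    funext π
    have := congr_fun (congr_fun h π.1.1) π.1.2
    simpa [hLsym_apply, LsymFun, π.2] using this
  have hsym : ∀ c (s t : Fin 5), Lsym c s t = Lsym c t s := by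
    intro c s t
    simp only [hLsym_apply, LsymFun]
    rcases lt_trichotomy s t with h | rfl | h
    · simp [h, not_lt.mpr h.le]
    · simp
    · simp [h, not_lt.mpr h.le]
  have hdiag : ∀ c (s : Fin 5), Lsym c s s = 0 := by
    intro c s
    simp [hLsym_apply, LsymFun]
  /- (4) the leaf evaluation map and its kernel (rank–nullity: dim ker ≥ 10 − n₃₄) -/
  let ev : (Fin 5 → Fin 5 → ℂ) →ₗ[ℂ] ((T.filter (fun t => S t = ({3, 4} : Finset (Fin 5)))) → ℂ) :=
    { toFun := fun M t => ∑ s : Fin 5, ∑ s' : Fin 5, M s s' * short2 (u t.1) 3 4 s s'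
      map_add' := by
        intro M M'
        funext t
        simp only [Pi.add_apply, add_mul, Finset.sum_add_distrib]
      map_smul' := by
        intro r M
        funext t
        simp only [Pi.smul_apply, smul_eq_mul, RingHom.id_apply, Finset.mul_sum, mul_assoc] }
  have hev_apply : ∀ M t, ev M t = ∑ s : Fin 5, ∑ s' : Fin 5, M s s' * short2 (u t.1) 3 4 s s' :=
    fun _ _ => rfl
  let ev' : (P → ℂ) →ₗ[ℂ] ((T.filter (fun t => S t = ({3, 4} : Finset (Fin 5)))) → ℂ) := ev ∘ₗ Lsym
  have hrn := LinearMap.finrank_range_add_finrank_ker ev'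
  rw [Module.finrank_fintype_fun_eq_card, hP] at hrn
  have hrange : Module.finrank ℂ (LinearMap.range ev')
      ≤ (T.filter (fun t => S t = ({3, 4} : Finset (Fin 5)))).card := by
    have := Submodule.finrank_le (LinearMap.range ev')
    rwa [Module.finrank_fintype_fun_eq_card, Fintype.card_coe] at this
  /- (5) the captured space W := Lsym (ker ev') and the capture inequality -/
  have hWK : Module.finrank ℂ ((LinearMap.ker ev').map Lsym) = Module.finrank ℂ (LinearMap.ker ev') :=
    (LinearEquiv.finrank_eq (Submodule.equivMapOfInjective Lsym hinj (LinearMap.ker ev'))).symm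
  have hcapW : Module.finrank ℂ ((LinearMap.ker ev').map Lsym)
      ≤ Module.finrank ℂ (shortSpan T S u 0 1) + Module.finrank ℂ (shortSpan T S u 0 2)
        + Module.finrank ℂ (shortSpan T S u 1 2) := by
    apply hcap
    · intro μ hμ s t
      obtain ⟨c, -, rfl⟩ := Submodule.mem_map.1 hμ
      exact hsym c s t
    · intro μ hμ s
      obtain ⟨c, -, rfl⟩ := Submodule.mem_map.1 hμ
      exact hdiag c s
    · intro μ hμ
      obtain ⟨c, hcK, rfl⟩ := Submodule.mem_map.1 hμ
      apply stub_obligation_captured N T S u w hc hex hsep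
      intro t ht h34
      have h0 := congr_fun (LinearMap.mem_ker.1 hcK) ⟨t, Finset.mem_filter.2 ⟨ht, h34⟩⟩
      rw [Pi.zero_apply] at h0
      simpa [ev', hev_apply] using h0
  /- (6) count -/
  have h01 := hm 0 1
  have h02 := hm 0 2
  have h12 := hm 1 2
  have h5 : Nat.factorial 5 = 120 := by decide
  rw [h5, hweight]
  omega

/-! ### Machinery for the converse construction (`stub_violation_honest`): coordinates on the ten leaf obligations,
the {3,4} | {0,1,2} Laplace identity, capture unpacking over bases, and the adapted basis of `ℂ¹⁰`. -/

/-- ordered pairs `s < t` (≅ the ten leaf obligations / 3-subsets by complement) -/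
abbrev P := {x : Fin 5 × Fin 5 // x.1 < x.2}

lemma card_P : Fintype.card P = 10 := by decide

/-- the symmetric zero-diagonal matrix with upper-triangular coordinates `c` -/
def Lsym (c : P → ℂ) (s t : Fin 5) : ℂ :=
  if h : s < t then c ⟨(s, t), h⟩ else if h' : t < s then c ⟨(t, s), h'⟩ else 0

lemma Lsym_add (c c' : P → ℂ) : Lsym (c + c') = Lsym c + Lsym c' := by
  funext s t; simp only [Lsym, Pi.add_apply]; split_ifs <;> simp
lemma Lsym_smul (r : ℂ) (c : P → ℂ) : Lsym (r • c) = r • Lsym c := by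
  funext s t; simp only [Lsym, Pi.smul_apply, smul_eq_mul]; split_ifs <;> simp
lemma Lsym_sum {ι : Type*} (s : Finset ι) (c : ι → P → ℂ) :
    Lsym (∑ i ∈ s, c i) = ∑ i ∈ s, Lsym (c i) := by
  classical
  induction s using Finset.induction_on with
  | empty => funext a b; simp [Lsym]
  | insert i s hi ih => rw [Finset.sum_insert hi, Finset.sum_insert hi, Lsym_add, ih]
lemma Lsym_symm (c : P → ℂ) (s t : Fin 5) : Lsym c s t = Lsym c t s := by
  simp only [Lsym]
  rcases lt_trichotomy s t with h | rfl | h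
  · simp [h, not_lt.mpr h.le]
  · simp
  · simp [h, not_lt.mpr h.le]
lemma Lsym_diag (c : P → ℂ) (s : Fin 5) : Lsym c s s = 0 := by simp [Lsym]

/-- the arrangement tensor of the obligation `π`: `x_π(p,q,r) = P₅(p,q,r,π₁,π₂)` -/
def xT (π : P) (p q r : Fin 5) : ℂ := perm5 (word p q r π.1.1 π.1.2)

lemma word_swap (p q r s t : Fin 5) : word p q r t s = word p q r s t ∘ Equiv.swap (3 : Fin 5) 4 := by
  funext i
  fin_cases i <;> simp [word, Equiv.swap_apply_of_ne_of_ne]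

lemma perm5_swap (p q r s t : Fin 5) : perm5 (word p q r t s) = perm5 (word p q r s t) := by
  unfold perm5
  rw [word_swap]
  by_cases h : Function.Injective (word p q r s t)
  · rw [if_pos h, if_pos (h.comp (Equiv.injective _))]
  · rw [if_neg h, if_neg]
    intro h'
    apply h
    have := h'.comp (Equiv.injective (Equiv.swap (3 : Fin 5) 4))
    simpa [Function.comp_assoc, ← Equiv.coe_trans, Equiv.swap_swap] using this

lemma perm5_rep (p q r s : Fin 5) : perm5 (word p q r s s) = 0 := by
  unfold perm5
  rw [if_neg]
  intro h
  have := @h 3 4 (by simp [word])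
  exact absurd this (by decide)

/-- the {3,4} | {0,1,2} Laplace identity in coordinates -/
lemma laplace34 (p q r s t : Fin 5) :
    perm5 (word p q r s t) = ∑ π : P, xT π p q r * Lsym (Pi.single π 1) s t := by
  rcases lt_trichotomy s t with h | rfl | h
  · have : ∀ π : P, xT π p q r * Lsym (Pi.single π 1) s t
        = if π = ⟨(s, t), h⟩ then perm5 (word p q r s t) else 0 := by
      intro π
      simp only [Lsym, h, dif_pos, Pi.single_apply]
      split_ifs with h1 h2 h2
      · subst h2; simp [xT]
      · exact absurd h1.symm h2
      · exact absurd h2.symm h1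
      · simp
    rw [Finset.sum_congr rfl (fun π _ => this π), Finset.sum_ite_eq']; simp
  · simp [perm5_rep, Lsym_diag]
  · have : ∀ π : P, xT π p q r * Lsym (Pi.single π 1) s t
        = if π = ⟨(t, s), h⟩ then perm5 (word p q r s t) else 0 := by
      intro π
      simp only [Lsym, h, not_lt.mpr h.le, dif_pos, dif_neg, Pi.single_apply, not_false_eq_true]
      split_ifs with h1 h2 h2
      · subst h2; simp [xT, perm5_swap]
      · exact absurd h1.symm h2
      · exact absurd h2.symm h1
      · simp
    rw [Finset.sum_congr rfl (fun π _ => this π), Finset.sum_ite_eq']; simp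

/-- obligation functional coordinates: `ν μ π = Σ_{s,t} μ s t · y_π(s,t)` (= `μ π₁ π₂ + μ π₂ π₁`) -/
def nu (μ : Fin 5 → Fin 5 → ℂ) (π : P) : ℂ := ∑ s : Fin 5, ∑ t : Fin 5, μ s t * Lsym (Pi.single π 1) s t

lemma contractZ_expand (μ : Fin 5 → Fin 5 → ℂ) (p q r : Fin 5) :
    contractZ μ p q r = ∑ π : P, nu μ π * xT π p q r := by
  unfold contractZ nu
  simp_rw [laplace34, Finset.mul_sum, Finset.sum_mul]
  calc (∑ s : Fin 5, ∑ t : Fin 5, ∑ π : P, μ s t * (xT π p q r * Lsym (Pi.single π 1) s t))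
      = ∑ s : Fin 5, ∑ π : P, ∑ t : Fin 5, μ s t * (xT π p q r * Lsym (Pi.single π 1) s t) := by
        refine Finset.sum_congr rfl fun s _ => Finset.sum_comm
    _ = ∑ π : P, ∑ s : Fin 5, ∑ t : Fin 5, μ s t * (xT π p q r * Lsym (Pi.single π 1) s t) := Finset.sum_comm
    _ = _ := by
        refine Finset.sum_congr rfl fun π _ => Finset.sum_congr rfl fun s _ => Finset.sum_congr rfl fun t _ => ?_
        ring

lemma Lsym_single_eq (π : P) (s t : Fin 5) :
    Lsym (Pi.single π 1) s t
      = (if s = π.1.1 ∧ t = π.1.2 then (1:ℂ) else 0) + (if s = π.1.2 ∧ t = π.1.1 then 1 else 0) := by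
  obtain ⟨⟨a, b⟩, hab⟩ := π
  simp only [Lsym, Pi.single_apply]
  rcases lt_trichotomy s t with h | rfl | h
  · simp only [h, dif_pos]
    have hne : ¬ (s = b ∧ t = a) := by rintro ⟨rfl, rfl⟩; exact lt_asymm h hab
    simp only [hne, if_false, add_zero]
    congr 1
    simp [Subtype.ext_iff, Prod.ext_iff]
  · have h1 : ¬ (s = a ∧ s = b) := by rintro ⟨rfl, rfl⟩; exact lt_irrefl _ hab
    have h2 : ¬ (s = b ∧ s = a) := by rintro ⟨rfl, rfl⟩; exact lt_irrefl _ hab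
    simp [h1, h2]
  · simp only [not_lt.mpr h.le, dif_neg, not_false_eq_true, h, dif_pos]
    have hne : ¬ (s = a ∧ t = b) := by rintro ⟨rfl, rfl⟩; exact lt_asymm h hab
    simp only [hne, if_false, zero_add]
    have hiff : (⟨(t, s), h⟩ : P) = ⟨(a, b), hab⟩ ↔ (s = b ∧ t = a) := by
      simp only [Subtype.ext_iff, Prod.ext_iff]
      constructor
      · rintro ⟨h1, h2⟩; exact ⟨h2, h1⟩
      · rintro ⟨h1, h2⟩; exact ⟨h2, h1⟩
    by_cases hc : s = b ∧ t = a
    · rw [if_pos (hiff.2 hc), if_pos hc]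
    · rw [if_neg (fun h' => hc (hiff.1 h')), if_neg hc]

lemma nu_apply (μ : Fin 5 → Fin 5 → ℂ) (π : P) : nu μ π = μ π.1.1 π.1.2 + μ π.1.2 π.1.1 := by
  unfold nu
  simp_rw [Lsym_single_eq, mul_add, Finset.sum_add_distrib]
  congr 1
  · rw [Finset.sum_eq_single π.1.1, Finset.sum_eq_single π.1.2]
    · simp
    · intro t _ ht; simp [ht]
    · simp
    · intro s _ hs; simp [hs]
    · simp
  · rw [Finset.sum_eq_single π.1.2, Finset.sum_eq_single π.1.1]
    · simp
    · intro t _ ht; simp [ht]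
    · simp
    · intro s _ hs; simp [hs]
    · simp

/-- `ν` kills exactly the non-(symmetric zero-diagonal) part: on symmetric zero-diagonal matrices it is injective -/
lemma eq_zero_of_nu (μ : Fin 5 → Fin 5 → ℂ) (hs : ∀ s t, μ s t = μ t s) (hd : ∀ s, μ s s = 0)
    (h : ∀ π, nu μ π = 0) : μ = 0 := by
  funext s t
  rcases lt_trichotomy s t with hlt | rfl | hlt
  · have := h ⟨(s, t), hlt⟩
    rw [nu_apply] at this
    simp only at this
    rw [hs t s] at this
    have : 2 * μ s t = 0 := by linear_combination this
    simpa using this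
  · simp [hd]
  · have := h ⟨(t, s), hlt⟩
    rw [nu_apply] at this
    simp only at this
    rw [hs t s] at this
    have : 2 * μ s t = 0 := by linear_combination this
    simpa using this

/-- regrouping map: long factors `g` over fixed short-factor families `b1 b2 b3` ↦ the triangle 3-tensor -/
def Phi {m1 m2 m3 : ℕ} (b1 : Fin m1 → Fin 5 → Fin 5 → ℂ) (b2 : Fin m2 → Fin 5 → Fin 5 → ℂ)
    (b3 : Fin m3 → Fin 5 → Fin 5 → ℂ) :
    ((Fin m1 → Fin 5 → ℂ) × (Fin m2 → Fin 5 → ℂ) × (Fin m3 → Fin 5 → ℂ)) →ₗ[ℂ] (Fin 5 → Fin 5 → Fin 5 → ℂ) where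
  toFun g := fun p q r => (∑ l, b1 l p q * g.1 l r) + (∑ l, b2 l p r * g.2.1 l q) + (∑ l, b3 l q r * g.2.2 l p)
  map_add' g g' := by
    funext p q r
    simp only [Prod.fst_add, Prod.snd_add, Pi.add_apply, mul_add, Finset.sum_add_distrib]
    ring
  map_smul' c g := by
    funext p q r
    simp only [Prod.smul_fst, Prod.smul_snd, Pi.smul_apply, smul_eq_mul, RingHom.id_apply]
    ring_nf
    simp only [Finset.mul_sum]
    ring_nf

lemma Phi_apply {m1 m2 m3 : ℕ} (b1 : Fin m1 → Fin 5 → Fin 5 → ℂ) (b2 : Fin m2 → Fin 5 → Fin 5 → ℂ)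
    (b3 : Fin m3 → Fin 5 → Fin 5 → ℂ) (g) (p q r : Fin 5) :
    Phi b1 b2 b3 g p q r = (∑ l, b1 l p q * g.1 l r) + (∑ l, b2 l p r * g.2.1 l q) + (∑ l, b3 l q r * g.2.2 l p) := rfl

lemma coe_eq_sum_repr {m : ℕ} {U : Submodule ℂ (Fin 5 → Fin 5 → ℂ)} (b : Module.Basis (Fin m) ℂ U)
    {u : Fin 5 → Fin 5 → ℂ} (hu : u ∈ U) (p q : Fin 5) :
    u p q = ∑ l, b.repr ⟨u, hu⟩ l * (b l : Fin 5 → Fin 5 → ℂ) p q := by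
  have h := congrArg (fun x : U => (x : Fin 5 → Fin 5 → ℂ) p q) (b.sum_repr ⟨u, hu⟩)
  simp only [Submodule.coe_sum, Submodule.coe_smul, Finset.sum_apply, Pi.smul_apply, smul_eq_mul] at h
  exact h.symm

lemma L3_le_range {m1 m2 m3 : ℕ} (U01 U02 U12 : Submodule ℂ (Fin 5 → Fin 5 → ℂ))
    (b1 : Module.Basis (Fin m1) ℂ U01) (b2 : Module.Basis (Fin m2) ℂ U02) (b3 : Module.Basis (Fin m3) ℂ U12) :
    L3 U01 U02 U12 ≤ LinearMap.range (Phi (fun l => (b1 l : Fin 5 → Fin 5 → ℂ)) (fun l => (b2 l : Fin 5 → Fin 5 → ℂ))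
      (fun l => (b3 l : Fin 5 → Fin 5 → ℂ))) := by
  apply Submodule.span_le.2
  rintro T ((⟨u, hu, y, rfl⟩ | ⟨u, hu, y, rfl⟩) | ⟨u, hu, y, rfl⟩)
  · refine ⟨(fun l r => b1.repr ⟨u, hu⟩ l * y r, 0, 0), ?_⟩
    funext p q r
    rw [Phi_apply]
    simp only [Pi.zero_apply, mul_zero, Finset.sum_const_zero, add_zero]
    rw [coe_eq_sum_repr b1 hu p q, Finset.sum_mul]
    exact Finset.sum_congr rfl fun l _ => by ring
  · refine ⟨(0, fun l q => b2.repr ⟨u, hu⟩ l * y q, 0), ?_⟩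
    funext p q r
    rw [Phi_apply]
    simp only [Pi.zero_apply, mul_zero, Finset.sum_const_zero, add_zero, zero_add]
    rw [coe_eq_sum_repr b2 hu p r, Finset.sum_mul]
    exact Finset.sum_congr rfl fun l _ => by ring
  · refine ⟨(0, 0, fun l p => b3.repr ⟨u, hu⟩ l * y p), ?_⟩
    funext p q r
    rw [Phi_apply]
    simp only [Pi.zero_apply, mul_zero, Finset.sum_const_zero, zero_add]
    rw [coe_eq_sum_repr b3 hu q r, Finset.sum_mul]
    exact Finset.sum_congr rfl fun l _ => by ring

/-! ### Layer 3: a basis of `P → ℂ` whose first block is `ν` of a basis of `W` -/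

/-- `ν` as a linear map -/
def nuL : (Fin 5 → Fin 5 → ℂ) →ₗ[ℂ] (P → ℂ) where
  toFun μ := fun π => nu μ π
  map_add' μ μ' := by funext π; simp [nu, add_mul, Finset.sum_add_distrib]
  map_smul' c μ := by funext π; simp [nu, Finset.mul_sum, mul_assoc]

lemma nuL_apply (μ : Fin 5 → Fin 5 → ℂ) (π : P) : nuL μ π = nu μ π := rfl

/-- linear independence of `ν ∘ (basis of W)` for a symmetric zero-diagonal `W` -/
lemma nu_basis_linearIndependent (W : Submodule ℂ (Fin 5 → Fin 5 → ℂ))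
    (hWs : ∀ μ ∈ W, ∀ s t : Fin 5, μ s t = μ t s) (hWd : ∀ μ ∈ W, ∀ s : Fin 5, μ s s = 0)
    {k : ℕ} (bW : Module.Basis (Fin k) ℂ W) :
    LinearIndependent ℂ (fun i => nuL (bW i : Fin 5 → Fin 5 → ℂ)) := by
  rw [Fintype.linearIndependent_iff]
  intro c hc i
  -- the combination `Σ c_i bW i` is an element of `W` killed by `ν`
  set μ : W := ∑ j, c j • bW j with hμ
  have hnu : ∀ π, nu (μ : Fin 5 → Fin 5 → ℂ) π = 0 := by
    intro π
    have := congr_fun hc π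
    simp only [Finset.sum_apply, Pi.smul_apply, smul_eq_mul, Pi.zero_apply] at this
    rw [hμ, Submodule.coe_sum]
    simp only [Submodule.coe_smul]
    have hlin : nu (∑ j, c j • (bW j : Fin 5 → Fin 5 → ℂ)) π = ∑ j, c j * nu (bW j : Fin 5 → Fin 5 → ℂ) π := by
      have := congr_fun (map_sum nuL (fun j => c j • (bW j : Fin 5 → Fin 5 → ℂ)) Finset.univ) π
      simp only [map_smul, Finset.sum_apply, Pi.smul_apply, smul_eq_mul, nuL_apply] at this
      exact this
    rw [hlin]
    simpa [nuL_apply] using this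
  have hμ0 : (μ : Fin 5 → Fin 5 → ℂ) = 0 :=
    eq_zero_of_nu _ (hWs _ μ.2) (hWd _ μ.2) hnu
  have hμ0' : μ = 0 := by ext1; simpa using hμ0
  have := Fintype.linearIndependent_iff.1 bW.linearIndependent c (by rw [← hμ]; exact hμ0') i
  exact this

lemma word_eta (v : Fin 5 → Fin 5) : word (v 0) (v 1) (v 2) (v 3) (v 4) = v := by
  funext i; fin_cases i <;> rfl

lemma Lsym_lincomb {ι : Type*} [Fintype ι] (a : ι → ℂ) (c : ι → P → ℂ) (s t : Fin 5) :
    (∑ J, a J * Lsym (c J) s t) = Lsym (fun π' => ∑ J, a J * c J π') s t := by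
  have : (fun π' => ∑ J, a J * c J π') = ∑ J, a J • c J := by
    funext π'; simp [Finset.sum_apply, Pi.smul_apply]
  rw [this, Lsym_sum]
  simp only [Finset.sum_apply, Lsym_smul, Pi.smul_apply, smul_eq_mul]

set_option maxHeartbeats 4000000 in
/-- CONVERSE (PROVED, r4), in refuter-standard shape (crit-3 g5 21:55:45Z (a)): a violation of `CaptureIneq` is an EXACT cheap term
system — the three clauses of the crux's `hdec` (both cylinder conditions, exactness on all 3125 words) on a {3,4}-separated pair profile,
weight counted `≤ 108 = 9·12`.  EXPLICIT CONSTRUCTION (no limits, no genericity), as formalised: coordinates `P = {(s,t) : s < t}` (≅ the ten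
3-subsets by complement), `y_π := Lsym e_π` the symmetric pair indicators, `x_π(p,q,r) := P₅(p,q,r,π₁,π₂)` the arrangement tensors, and the
{3,4} | {0,1,2} Laplace identity `P₅(p,q,r,s,t) = Σ_π x_π(p,q,r) · y_π(s,t)` (`laplace34`).  Given triangle spans `U_ab` (bases `b^{ab}`, `m_Δ`
forms) and a captured symmetric zero-diagonal `W` of dimension `k ≥ m_Δ + 1`: the obligation vectors `ν(μ_i) ∈ ℂ^P` of a basis `μ_i` of `W` are
linearly independent (`ν` is injective on symmetric zero-diagonal matrices); complete them through a complement `Q` (dim `10 − k`) to a basis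
`bE` of `ℂ^P` and rewrite the identity tensor `Σ_π e^π ⊗ e_π = Σ_J bE_J ⊗ bE^J`: `P₅ = Σ_J X_J ⊗ Y_J` with `X_J := Σ_π (bE J)_π x_π`,
`Y_J := Lsym (J-th coordinate row)`.  The `W`-block has `X_{inl i} = Σ_π ν(μ_i)_π x_π = T_{μ_i}` (`contractZ_expand`), which is CAPTURED, i.e. in the
range of the regrouping map `Phi` over the bases `b^{ab}` (`L3_le_range`): `T_{μ_i} = Σ_l b^{01}_l ⊗₂ g¹_{il} + Σ_l b^{02}_l ⊗₁ g²_{il} + Σ_l b^{12}_l ⊗₀ g³_{il}`;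
summing over `i` and regrouping gives ONE TRIANGLE TERM per basis form `b^{ab}_l` (long factor `Σ_i g_{il} ⊗ Y_{inl i}` on slots c,3,4); the
`Q`-block gives `10 − k` LEAF TERMS `Y_{inr j} ⊗ X_{inr j}`.  Terms: `(10 − k) + m_Δ ≤ 9`, each of weight `2!·3! = 12`, so weight `≤ 108`.
Composed with the crux this is a conditional refutation (`violation_refutes`, below). -/
theorem stub_violation_honest :
    ¬ CaptureIneq →
    ∃ (N : ℕ) (T : Finset (Fin N)) (S : Fin N → Finset (Fin 5)) (u w : Fin N → (Fin 5 → Fin 5) → ℂ),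
      Cylindrical S u w ∧ (∀ v : Fin 5 → Fin 5, (∑ t ∈ T, u t v * w t v) = perm5 v) ∧ SepProfile34 T S ∧
      weight T S ≤ 108 := by
  intro hnc
  classical
  unfold CaptureIneq at hnc
  push Not at hnc
  obtain ⟨U01, U02, U12, W, hWs, hWd, hWc, hlt⟩ := hnc
  -- bases of the four spaces
  let b1 := Module.finBasis ℂ U01
  let b2 := Module.finBasis ℂ U02
  let b3 := Module.finBasis ℂ U12
  let bW := Module.finBasis ℂ W
  -- the obligation vectors of a basis of `W` are independent in `P → ℂ`; complete them to a basis through a complement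
  let f0 : Fin (Module.finrank ℂ W) → (P → ℂ) := fun i => nuL (bW i : Fin 5 → Fin 5 → ℂ)
  have hli : LinearIndependent ℂ f0 := nu_basis_linearIndependent W hWs hWd bW
  let Nsp : Submodule ℂ (P → ℂ) := Submodule.span ℂ (Set.range f0)
  obtain ⟨Q, hQ⟩ := Nsp.exists_isCompl
  let bN : Module.Basis (Fin (Module.finrank ℂ W)) ℂ Nsp := Module.Basis.span hli
  let bQ : Module.Basis (Fin (Module.finrank ℂ Q)) ℂ Q := Module.finBasis ℂ Q
  let bE : Module.Basis (Fin (Module.finrank ℂ W) ⊕ Fin (Module.finrank ℂ Q)) ℂ (P → ℂ) :=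
    (bN.prod bQ).map (Submodule.prodEquivOfIsCompl Nsp Q hQ)
  have hbE_inl : ∀ i, bE (Sum.inl i) = f0 i := by
    intro i
    simp [bE, bN, Module.Basis.map_apply]
    exact congrArg Subtype.val (Module.Basis.span_apply hli i)
  have hdim : Module.finrank ℂ W + Module.finrank ℂ Q = 10 := by
    have h1 : Module.finrank ℂ Nsp = Module.finrank ℂ W := by
      rw [finrank_span_eq_card hli, Fintype.card_fin]
    have h2 := Submodule.finrank_add_eq_of_isCompl hQ
    rw [h1, Module.finrank_fintype_fun_eq_card, card_P] at h2
    exact h2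
  -- capture unpacking
  have hcapt : ∀ i : Fin (Module.finrank ℂ W), ∃ g,
      Phi (fun l => (b1 l : Fin 5 → Fin 5 → ℂ)) (fun l => (b2 l : Fin 5 → Fin 5 → ℂ)) (fun l => (b3 l : Fin 5 → Fin 5 → ℂ)) g
        = contractZ (bW i : Fin 5 → Fin 5 → ℂ) := by
    intro i
    exact LinearMap.mem_range.1 (L3_le_range U01 U02 U12 b1 b2 b3 (hWc _ (bW i).2))
  choose g hg using hcapt
  -- long / short factors of the rewritten Laplace identity
  let X : (Fin (Module.finrank ℂ W) ⊕ Fin (Module.finrank ℂ Q)) → Fin 5 → Fin 5 → Fin 5 → ℂ :=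
    fun J p q r => ∑ π : P, bE J π * xT π p q r
  let Y : (Fin (Module.finrank ℂ W) ⊕ Fin (Module.finrank ℂ Q)) → Fin 5 → Fin 5 → ℂ :=
    fun J => Lsym (fun π' => bE.repr (Pi.single π' 1) J)
  have hY : ∀ (π : P) (s t : Fin 5), Lsym (Pi.single π 1) s t = ∑ J, bE J π * Y J s t := by
    intro π s t
    rw [Lsym_lincomb]
    congr 1
    funext π'
    have h := congr_fun (bE.sum_repr (Pi.single π' (1:ℂ))) π
    simp only [Finset.sum_apply, Pi.smul_apply, smul_eq_mul] at h
    rw [show (Pi.single π (1:ℂ) : P → ℂ) π' = (Pi.single π' (1:ℂ) : P → ℂ) π from by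
      simp [Pi.single_apply, eq_comm], ← h]
    exact Finset.sum_congr rfl fun J _ => mul_comm _ _
  have key : ∀ p q r s t : Fin 5, perm5 (word p q r s t) = ∑ J, X J p q r * Y J s t := by
    intro p q r s t
    rw [laplace34]
    simp_rw [hY, Finset.mul_sum]
    rw [Finset.sum_comm]
    refine Finset.sum_congr rfl fun J _ => ?_
    simp only [X, Finset.sum_mul]
    exact Finset.sum_congr rfl fun π _ => by ring
  have hXinl : ∀ i p q r, X (Sum.inl i) p q r = contractZ (bW i : Fin 5 → Fin 5 → ℂ) p q r := by
    intro i p q r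
    simp only [X, hbE_inl, f0, nuL_apply]
    rw [contractZ_expand]
  -- the term system, indexed by a sum type
  let Jt := Fin (Module.finrank ℂ Q) ⊕ (Fin (Module.finrank ℂ U01) ⊕ (Fin (Module.finrank ℂ U02) ⊕ Fin (Module.finrank ℂ U12)))
  let St : Jt → Finset (Fin 5) := Sum.elim (fun _ => {3, 4})
    (Sum.elim (fun _ => {0, 1}) (Sum.elim (fun _ => {0, 2}) (fun _ => {1, 2})))
  let ut : Jt → (Fin 5 → Fin 5) → ℂ := Sum.elim (fun j v => Y (Sum.inr j) (v 3) (v 4))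
    (Sum.elim (fun l v => (b1 l : Fin 5 → Fin 5 → ℂ) (v 0) (v 1))
      (Sum.elim (fun l v => (b2 l : Fin 5 → Fin 5 → ℂ) (v 0) (v 2))
        (fun l v => (b3 l : Fin 5 → Fin 5 → ℂ) (v 1) (v 2))))
  let wt : Jt → (Fin 5 → Fin 5) → ℂ := Sum.elim (fun j v => X (Sum.inr j) (v 0) (v 1) (v 2))
    (Sum.elim (fun l v => ∑ i, (g i).1 l (v 2) * Y (Sum.inl i) (v 3) (v 4))
      (Sum.elim (fun l v => ∑ i, (g i).2.1 l (v 1) * Y (Sum.inl i) (v 3) (v 4))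
        (fun l v => ∑ i, (g i).2.2 l (v 0) * Y (Sum.inl i) (v 3) (v 4))))
  let e : Jt ≃ Fin (Fintype.card Jt) := Fintype.equivFin Jt
  refine ⟨Fintype.card Jt, Finset.univ, St ∘ e.symm, ut ∘ e.symm, wt ∘ e.symm, ?_, ?_, ?_, ?_⟩
  · -- cylindrical
    constructor
    · intro t v v' hvv'
      simp only [Function.comp_apply] at hvv' ⊢
      generalize e.symm t = j at hvv' ⊢
      rcases j with j | l | l | l <;> simp only [St, ut, Sum.elim_inl, Sum.elim_inr] at hvv' ⊢
      · rw [hvv' 3 (by simp), hvv' 4 (by simp)]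
      · rw [hvv' 0 (by simp), hvv' 1 (by simp)]
      · rw [hvv' 0 (by simp), hvv' 2 (by simp)]
      · rw [hvv' 1 (by simp), hvv' 2 (by simp)]
    · intro t v v' hvv'
      simp only [Function.comp_apply] at hvv' ⊢
      generalize e.symm t = j at hvv' ⊢
      rcases j with j | l | l | l <;> simp only [St, wt, Sum.elim_inl, Sum.elim_inr] at hvv' ⊢
      · rw [hvv' 0 (by decide), hvv' 1 (by decide), hvv' 2 (by decide)]
      · rw [hvv' 2 (by decide), hvv' 3 (by decide), hvv' 4 (by decide)]
      · rw [hvv' 1 (by decide), hvv' 3 (by decide), hvv' 4 (by decide)]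
      · rw [hvv' 0 (by decide), hvv' 3 (by decide), hvv' 4 (by decide)]
  · -- exact
    intro v
    rw [← word_eta v, key]
    simp only [word_eta]
    rw [show (∑ t ∈ (Finset.univ : Finset (Fin (Fintype.card Jt))), (ut ∘ e.symm) t v * (wt ∘ e.symm) t v)
        = ∑ j : Jt, ut j v * wt j v from by
          rw [← Equiv.sum_comp e.symm (fun j => ut j v * wt j v)]
          rfl]
    rw [Fintype.sum_sum_type, Fintype.sum_sum_type, Fintype.sum_sum_type, Fintype.sum_sum_type]
    simp only [ut, wt, Sum.elim_inl, Sum.elim_inr]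
    -- captured block: Σ_i X(inl i) Y(inl i) = the three triangle blocks
    have hblk : ∀ i, X (Sum.inl i) (v 0) (v 1) (v 2)
        = (∑ l, (b1 l : Fin 5 → Fin 5 → ℂ) (v 0) (v 1) * (g i).1 l (v 2))
          + (∑ l, (b2 l : Fin 5 → Fin 5 → ℂ) (v 0) (v 2) * (g i).2.1 l (v 1))
          + (∑ l, (b3 l : Fin 5 → Fin 5 → ℂ) (v 1) (v 2) * (g i).2.2 l (v 0)) := by
      intro i
      rw [hXinl, ← hg i, Phi_apply]
    simp_rw [hblk, add_mul, Finset.sum_add_distrib, Finset.sum_mul, Finset.mul_sum]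
    rw [Finset.sum_comm (f := fun l i => (b1 l : Fin 5 → Fin 5 → ℂ) (v 0) (v 1) * ((g i).1 l (v 2) * Y (Sum.inl i) (v 3) (v 4)))]
    rw [Finset.sum_comm (f := fun l i => (b2 l : Fin 5 → Fin 5 → ℂ) (v 0) (v 2) * ((g i).2.1 l (v 1) * Y (Sum.inl i) (v 3) (v 4)))]
    rw [Finset.sum_comm (f := fun l i => (b3 l : Fin 5 → Fin 5 → ℂ) (v 1) (v 2) * ((g i).2.2 l (v 0) * Y (Sum.inl i) (v 3) (v 4)))]
    have e3 : ∀ (a b c : ℂ), a * b * c = a * (b * c) := fun a b c => mul_assoc a b c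
    simp_rw [e3]
    rw [show (∑ x, Y (Sum.inr x) (v 3) (v 4) * X (Sum.inr x) (v 0) (v 1) (v 2))
        = ∑ x, X (Sum.inr x) (v 0) (v 1) (v 2) * Y (Sum.inr x) (v 3) (v 4) from
      Finset.sum_congr rfl (fun _ _ => mul_comm _ _)]
    ring
  · -- separated profile
    intro t _
    simp only [Function.comp_apply]
    generalize e.symm t = j
    rcases j with j | l | l | l <;> simp [St]
  · -- weight ≤ 108
    have hw : weight Finset.univ (St ∘ e.symm) = ∑ t : Fin (Fintype.card Jt), 12 := by
      unfold weight
      refine Finset.sum_congr rfl fun t _ => ?_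
      simp only [Function.comp_apply]
      generalize e.symm t = j
      rcases j with j | l | l | l <;> simp [St] <;> decide
    rw [hw, Finset.sum_const, Finset.card_univ, Fintype.card_fin, smul_eq_mul]
    have hcard : Fintype.card Jt = Module.finrank ℂ Q + (Module.finrank ℂ U01 + (Module.finrank ℂ U02 + Module.finrank ℂ U12)) := by
      simp [Jt, Fintype.card_sum, Fintype.card_fin]
    rw [hcard]
    omega


/-! ### Checked glue: the separated case IS a sub-case of the crux (the honest direction `S → C`). -/
theorem separated_of_laplaceOptimalFive
    (h : Summit.ValiantsHypothesis.ValiantsHypothesis.Theses.RigidityForcesSymmetry.LaplaceOptimalFive) :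
    ∀ (N : ℕ) (T : Finset (Fin N)) (S : Fin N → Finset (Fin 5)) (u w : Fin N → (Fin 5 → Fin 5) → ℂ),
      Cylindrical S u w → (∀ v : Fin 5 → Fin 5, (∑ t ∈ T, u t v * w t v) = perm5 v) → SepProfile34 T S →
      Nat.factorial 5 ≤ weight T S := by
  intro N T S u w hc hex _
  exact h N T S u w hc.1 hc.2 (fun v => by simpa [perm5] using hex v)

/-- PROVED COMPOSITION: a violation of the capture inequality refutes the crux (through `stub_violation_honest` only). -/
theorem violation_refutes (hv : ¬ CaptureIneq) :
    ¬ Summit.ValiantsHypothesis.ValiantsHypothesis.Theses.RigidityForcesSymmetry.LaplaceOptimalFive := by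
  intro h
  obtain ⟨N, T, S, u, w, hc, hex, hsep, hwt⟩ := stub_violation_honest hv
  have h120 := separated_of_laplaceOptimalFive h N T S u w hc hex hsep
  have h5 : Nat.factorial 5 = 120 := by decide
  omega

/-! ### Leaf rigidity (crit-3 g5 21:55:45Z (b)) — a COROLLARY of the elimination, not an imported lemma.
Honest decomposability with spans `(U_Δ, U₃₄)` ⟺ `N(U₃₄) ⊆ Cap(U_Δ)` where `N(U₃₄) := (U₃₄ ∩ Sym₀)^⊥ ⊂ Sym₀^*`: a functional `ψ` on `Sym₀`
extends to a matrix functional `μ` killing `U₃₄` iff `ψ` kills `U₃₄ ∩ Sym₀` (extend from `U₃₄ + Sym₀`), and `T_μ` depends on `μ` only through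
`ψ = μ|_{Sym₀}` (antisymmetric and diagonal parts pair to zero with every `y_C`).  Hence decomposability depends on the leaf span only through
`U₃₄ ∩ Sym₀`, and (⟹)+(⟸) rebuild from ANY honest separated system one with the same triangle spans, leaf span `U₃₄ ∩ Sym₀` (symmetric = leaf
side-symmetric, zero-diagonal = leaf on-shell) and weight `≤` the old weight.  No disjunct of S3′ and no ✓ tree lemma is invoked; the star / C₄
side-symmetry theorems (p665006, p669391) are about other profiles. -/

/-- Sanity: the obligation tensor of the elementary symmetric leaf matrix `e₃₄ + e₄₃` is the arrangement indicator of
`{0,1,2}` — value 1 at the injective triple `(0,1,2)`. -/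
example : perm5 (word 0 1 2 3 4) = 1 := by
  simp [perm5, word]
  decide

/-! ### r5 — RANK-ONE (SUB-PERMANENT) WITNESSES (memo 2 `SeparatedCaptureSubpermanent.md` §4, W-lemma).
In the Boolean algebra `B₅ = ℂ[x₀..x₄]/(x_p²)` the capture number is `cap = 10 − dim μ(L₃^⊥)` (μ = multiplication `V^{⊗3} → R₃`), the proved
direction is the hard-Lefschetz injectivity of `×(x₀+…+x₄) : R₂ → R₃` (`hub_injective`), and a decomposable element `α ⊗ β ⊗ γ ∈ L₃^⊥` — a
PAIRWISE-ISOTROPIC triple — maps to the product `αβγ = Σ_C per₃[α;β;γ]_C · x_C`.  The functional `T ↦ Σ T p q r · α_p β_q γ_r` therefore kills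
every captured obligation; if some `3 × 3` sub-permanent of `[α;β;γ]` is non-zero this bounds `cap ≤ 9` (k independent products: `cap ≤ 10 − k`).
Nothing here closes the crux; `RankOneWitness45` below is OPEN (memo 2 §5 lists the proved shapes and the open 4-letter normal forms). -/

/-- The rank-one functional of a triple of vectors: `Θ_{α,β,γ}(T) = Σ_{p,q,r} T p q r · (α p · β q · γ r)`. -/
def tripleEval (α β γ : Fin 5 → ℂ) : (Fin 5 → Fin 5 → Fin 5 → ℂ) →ₗ[ℂ] ℂ where
  toFun T := ∑ p : Fin 5, ∑ q : Fin 5, ∑ r : Fin 5, T p q r * (α p * β q * γ r)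
  map_add' T T' := by
    simp only [Pi.add_apply, add_mul, Finset.sum_add_distrib]
  map_smul' c T := by
    simp only [Pi.smul_apply, smul_eq_mul, RingHom.id_apply, Finset.mul_sum, mul_assoc]

lemma tripleEval_apply (α β γ : Fin 5 → ℂ) (T : Fin 5 → Fin 5 → Fin 5 → ℂ) :
    tripleEval α β γ T = ∑ p : Fin 5, ∑ q : Fin 5, ∑ r : Fin 5, T p q r * (α p * β q * γ r) := rfl

lemma tripleEval_gen01 (α β γ : Fin 5 → ℂ) (u : Fin 5 → Fin 5 → ℂ) (y : Fin 5 → ℂ) :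
    tripleEval α β γ (fun p q r => u p q * y r) = (∑ p : Fin 5, ∑ q : Fin 5, u p q * (α p * β q)) * (∑ r : Fin 5, y r * γ r) := by
  rw [tripleEval_apply, Finset.sum_mul]
  refine Finset.sum_congr rfl fun p _ => ?_
  rw [Finset.sum_mul]
  refine Finset.sum_congr rfl fun q _ => ?_
  rw [Finset.mul_sum]
  exact Finset.sum_congr rfl fun r _ => by ring

lemma tripleEval_gen02 (α β γ : Fin 5 → ℂ) (u : Fin 5 → Fin 5 → ℂ) (y : Fin 5 → ℂ) :
    tripleEval α β γ (fun p q r => u p r * y q) = (∑ p : Fin 5, ∑ r : Fin 5, u p r * (α p * γ r)) * (∑ q : Fin 5, y q * β q) := by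
  rw [tripleEval_apply, Finset.sum_mul]
  refine Finset.sum_congr rfl fun p _ => ?_
  rw [Finset.sum_mul]
  conv_lhs => rw [Finset.sum_comm]
  refine Finset.sum_congr rfl fun r _ => ?_
  rw [Finset.mul_sum]
  exact Finset.sum_congr rfl fun q _ => by ring

lemma tripleEval_gen12 (α β γ : Fin 5 → ℂ) (u : Fin 5 → Fin 5 → ℂ) (y : Fin 5 → ℂ) :
    tripleEval α β γ (fun p q r => u q r * y p) = (∑ q : Fin 5, ∑ r : Fin 5, u q r * (β q * γ r)) * (∑ p : Fin 5, y p * α p) := by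
  rw [tripleEval_apply]
  conv_lhs => rw [Finset.sum_comm]
  rw [Finset.sum_mul]
  refine Finset.sum_congr rfl fun q _ => ?_
  conv_lhs => rw [Finset.sum_comm]
  rw [Finset.sum_mul]
  refine Finset.sum_congr rfl fun r _ => ?_
  rw [Finset.mul_sum]
  exact Finset.sum_congr rfl fun p _ => by ring

/-- W-LEMMA (load-bearing half): a PAIRWISE-ISOTROPIC triple `(α,β,γ)` — `U₀₁(α,β) = 0`, `U₀₂(α,γ) = 0`, `U₁₂(β,γ) = 0` — gives a functional
vanishing on the whole triangle configuration space `L₃`. -/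
theorem tripleEval_L3_eq_zero (U01 U02 U12 : Submodule ℂ (Fin 5 → Fin 5 → ℂ)) (α β γ : Fin 5 → ℂ)
    (h01 : ∀ u ∈ U01, ∑ p : Fin 5, ∑ q : Fin 5, u p q * (α p * β q) = 0)
    (h02 : ∀ u ∈ U02, ∑ p : Fin 5, ∑ r : Fin 5, u p r * (α p * γ r) = 0)
    (h12 : ∀ u ∈ U12, ∑ q : Fin 5, ∑ r : Fin 5, u q r * (β q * γ r) = 0) :
    L3 U01 U02 U12 ≤ LinearMap.ker (tripleEval α β γ) := by
  apply Submodule.span_le.2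
  rintro T ((⟨u, hu, y, rfl⟩ | ⟨u, hu, y, rfl⟩) | ⟨u, hu, y, rfl⟩)
  · simp only [SetLike.mem_coe, LinearMap.mem_ker, tripleEval_gen01, h01 u hu, zero_mul]
  · simp only [SetLike.mem_coe, LinearMap.mem_ker, tripleEval_gen02, h02 u hu, zero_mul]
  · simp only [SetLike.mem_coe, LinearMap.mem_ker, tripleEval_gen12, h12 u hu, zero_mul]

/-- W-LEMMA, obligation form: every CAPTURED obligation `contractZ ν ∈ L₃` is killed by the rank-one functional of any pairwise-isotropic
triple; its value on `contractZ ν` is `Σ_{p,q,r,s,t} ν s t · perm5(p q r s t) · α_p β_q γ_r` (= `2 Σ_C ν_{C^c} · per₃[α;β;γ]_C`).  Hence if some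
`3 × 3` sub-permanent of `[α;β;γ]` is non-zero, not every symmetric zero-diagonal `ν` is captured (`cap ≤ 9`). -/
theorem witness_annihilates (U01 U02 U12 : Submodule ℂ (Fin 5 → Fin 5 → ℂ)) (α β γ : Fin 5 → ℂ)
    (h01 : ∀ u ∈ U01, ∑ p : Fin 5, ∑ q : Fin 5, u p q * (α p * β q) = 0)
    (h02 : ∀ u ∈ U02, ∑ p : Fin 5, ∑ r : Fin 5, u p r * (α p * γ r) = 0)
    (h12 : ∀ u ∈ U12, ∑ q : Fin 5, ∑ r : Fin 5, u q r * (β q * γ r) = 0)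
    (ν : Fin 5 → Fin 5 → ℂ) (hν : contractZ ν ∈ L3 U01 U02 U12) :
    ∑ p : Fin 5, ∑ q : Fin 5, ∑ r : Fin 5, contractZ ν p q r * (α p * β q * γ r) = 0 := by
  have h := tripleEval_L3_eq_zero U01 U02 U12 α β γ h01 h02 h12 hν
  rwa [LinearMap.mem_ker, tripleEval_apply] at h

/-- The `3 × 3` sub-permanent of the rows `α, β, γ` on the columns `{p,q,r}` (the coefficient of `x_p x_q x_r` in `αβγ ∈ B₅`). -/
def per3 (α β γ : Fin 5 → ℂ) (p q r : Fin 5) : ℂ :=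
  α p * (β q * γ r + β r * γ q) + α q * (β p * γ r + β r * γ p) + α r * (β p * γ q + β q * γ p)

/-- OPEN (memo 2 §4–5): RANK-ONE WITNESS CONJECTURE for the two-direction residue `(m₀₁, m₀₂) = (4, 5)`: for any `≤ 4` forms on slots `(0,1)`
and `≤ 5` forms on slots `(0,2)` there is a pairwise-isotropic triple with a non-zero `3 × 3` sub-permanent.  With `witness_annihilates` it gives
`cap ≤ 9 = m` there, i.e. `CaptureIneq` at (4,5) and (by the slot symmetry) (5,4).  Proved shapes / open 4-letter normal forms: memo 2 §5. -/
def RankOneWitness45 : Prop :=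
  ∀ (m₁ m₂ : ℕ) (u₁ : Fin m₁ → Fin 5 → Fin 5 → ℂ) (u₂ : Fin m₂ → Fin 5 → Fin 5 → ℂ), m₁ ≤ 4 → m₂ ≤ 5 →
    ∃ α β γ : Fin 5 → ℂ,
      (∀ i, ∑ p : Fin 5, ∑ q : Fin 5, u₁ i p q * (α p * β q) = 0) ∧
      (∀ j, ∑ p : Fin 5, ∑ r : Fin 5, u₂ j p r * (α p * γ r) = 0) ∧
      ∃ p q r : Fin 5, p ≠ q ∧ p ≠ r ∧ q ≠ r ∧ per3 α β γ p q r ≠ 0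

/-- Sanity (the Laplace witness): `α = β = γ = 𝟙` has `per3 = 6 ≠ 0` on `{0,1,2}`. -/
example : per3 (fun _ => 1) (fun _ => 1) (fun _ => 1) 0 1 2 = 6 := by
  simp [per3]; norm_num


/-! ## r6 (2026-08-29): ONE WITNESS ⇒ `finrank W ≤ 9` — the finrank form of `witness_annihilates`
(so `RankOneWitness45`-type statements feed `CaptureIneq` at the profiles (4,5)/(5,4) directly). -/

/-- The obligation coordinate of a triple at the leaf pair `π`: `A_π(α,β,γ) = Σ_{p,q,r} xT π p q r · α_p β_q γ_r`
(the `3 × 3` sub-permanent of `[α;β;γ]` on the three letters complementary to `π`). -/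
def obl (α β γ : Fin 5 → ℂ) (π : P) : ℂ :=
  ∑ p : Fin 5, ∑ q : Fin 5, ∑ r : Fin 5, xT π p q r * (α p * β q * γ r)

/-- the functional `c ↦ Σ_π c_π · A_π(α,β,γ)` on the obligation coordinate space `P → ℂ` -/
def oblL (α β γ : Fin 5 → ℂ) : (P → ℂ) →ₗ[ℂ] ℂ where
  toFun c := ∑ π : P, c π * obl α β γ π
  map_add' c c' := by
    simp only [Pi.add_apply, add_mul, Finset.sum_add_distrib]
  map_smul' a c := by
    simp only [Pi.smul_apply, smul_eq_mul, RingHom.id_apply, Finset.mul_sum, mul_assoc]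

lemma oblL_apply (α β γ : Fin 5 → ℂ) (c : P → ℂ) : oblL α β γ c = ∑ π : P, c π * obl α β γ π := rfl

lemma oblL_single (α β γ : Fin 5 → ℂ) (π₀ : P) : oblL α β γ (Pi.single π₀ 1) = obl α β γ π₀ := by
  rw [oblL_apply, Finset.sum_eq_single π₀]
  · simp
  · intro π _ hπ; simp [Pi.single_apply, hπ]
  · simp

/-- `Θ_{α,β,γ}(contractZ ν) = Σ_π ν_π · A_π(α,β,γ)`: the rank-one functional on an obligation tensor, in leaf coordinates. -/
lemma tripleEval_contractZ (α β γ : Fin 5 → ℂ) (ν : Fin 5 → Fin 5 → ℂ) :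
    (∑ p : Fin 5, ∑ q : Fin 5, ∑ r : Fin 5, contractZ ν p q r * (α p * β q * γ r)) = oblL α β γ (nuL ν) := by
  rw [oblL_apply]
  have hR : ∀ π : P, nuL ν π * obl α β γ π
      = ∑ p : Fin 5, ∑ q : Fin 5, ∑ r : Fin 5, nu ν π * xT π p q r * (α p * β q * γ r) := by
    intro π
    rw [nuL_apply, obl, Finset.mul_sum]
    refine Finset.sum_congr rfl fun p _ => ?_
    rw [Finset.mul_sum]
    refine Finset.sum_congr rfl fun q _ => ?_
    rw [Finset.mul_sum]
    exact Finset.sum_congr rfl fun r _ => by ring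
  rw [Finset.sum_congr rfl (fun π _ => hR π)]
  symm
  calc (∑ π : P, ∑ p : Fin 5, ∑ q : Fin 5, ∑ r : Fin 5, nu ν π * xT π p q r * (α p * β q * γ r))
      = ∑ p : Fin 5, ∑ π : P, ∑ q : Fin 5, ∑ r : Fin 5, nu ν π * xT π p q r * (α p * β q * γ r) :=
        Finset.sum_comm
    _ = ∑ p : Fin 5, ∑ q : Fin 5, ∑ π : P, ∑ r : Fin 5, nu ν π * xT π p q r * (α p * β q * γ r) :=
        Finset.sum_congr rfl fun p _ => Finset.sum_comm
    _ = ∑ p : Fin 5, ∑ q : Fin 5, ∑ r : Fin 5, ∑ π : P, nu ν π * xT π p q r * (α p * β q * γ r) :=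
        Finset.sum_congr rfl fun p _ => Finset.sum_congr rfl fun q _ => Finset.sum_comm
    _ = ∑ p : Fin 5, ∑ q : Fin 5, ∑ r : Fin 5, contractZ ν p q r * (α p * β q * γ r) := by
        refine Finset.sum_congr rfl fun p _ => Finset.sum_congr rfl fun q _ => Finset.sum_congr rfl fun r _ => ?_
        rw [contractZ_expand, Finset.sum_mul]

/-- ONE WITNESS ⇒ cap ≤ 9.  If a pairwise-isotropic triple `(α,β,γ)` for the triangle configuration `(U₀₁,U₀₂,U₁₂)` has a
non-zero obligation coordinate `A_{π₀}(α,β,γ) ≠ 0` (a non-zero `3 × 3` sub-permanent), then every symmetric zero-diagonal `W`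
whose obligations are all captured has `finrank W ≤ 9`: the injective coordinate map `ν : W → (P → ℂ)` lands in the kernel of
the non-zero functional `oblL α β γ` (by `witness_annihilates`), a hyperplane of the 10-dimensional leaf space. -/
theorem finrank_le_nine_of_witness (U01 U02 U12 W : Submodule ℂ (Fin 5 → Fin 5 → ℂ))
    (hWs : ∀ μ ∈ W, ∀ s t : Fin 5, μ s t = μ t s) (hWd : ∀ μ ∈ W, ∀ s : Fin 5, μ s s = 0)
    (hWc : ∀ μ ∈ W, contractZ μ ∈ L3 U01 U02 U12) (α β γ : Fin 5 → ℂ)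
    (h01 : ∀ u ∈ U01, ∑ p : Fin 5, ∑ q : Fin 5, u p q * (α p * β q) = 0)
    (h02 : ∀ u ∈ U02, ∑ p : Fin 5, ∑ r : Fin 5, u p r * (α p * γ r) = 0)
    (h12 : ∀ u ∈ U12, ∑ q : Fin 5, ∑ r : Fin 5, u q r * (β q * γ r) = 0)
    (π₀ : P) (hne : obl α β γ π₀ ≠ 0) :
    Module.finrank ℂ W ≤ 9 := by
  classical
  -- (1) `ν(W) ⊆ ker oblL`
  have hker : ∀ μ ∈ W, nuL μ ∈ LinearMap.ker (oblL α β γ) := by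
    intro μ hμ
    rw [LinearMap.mem_ker, ← tripleEval_contractZ]
    exact witness_annihilates U01 U02 U12 α β γ h01 h02 h12 μ (hWc μ hμ)
  -- (2) the co-restricted coordinate map is injective
  let f : W →ₗ[ℂ] LinearMap.ker (oblL α β γ) :=
    LinearMap.codRestrict (LinearMap.ker (oblL α β γ)) (nuL.comp W.subtype) (fun μ => hker μ μ.2)
  have hf : Function.Injective f := by
    intro μ μ' h
    have h' : ∀ π, nu (μ : Fin 5 → Fin 5 → ℂ) π = nu (μ' : Fin 5 → Fin 5 → ℂ) π := by
      intro π
      have := congr_fun (congrArg Subtype.val h) π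
      simpa [f, nuL_apply] using this
    have hz : ((μ : Fin 5 → Fin 5 → ℂ) - (μ' : Fin 5 → Fin 5 → ℂ)) = 0 := by
      refine eq_zero_of_nu _ ?_ ?_ ?_
      · intro s t
        simp only [Pi.sub_apply]
        rw [hWs _ μ.2 s t, hWs _ μ'.2 s t]
      · intro s
        simp only [Pi.sub_apply]
        rw [hWd _ μ.2 s, hWd _ μ'.2 s, sub_zero]
      · intro π
        have hlin : nu ((μ : Fin 5 → Fin 5 → ℂ) - μ') π
            = nu (μ : Fin 5 → Fin 5 → ℂ) π - nu (μ' : Fin 5 → Fin 5 → ℂ) π := by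
          have := congr_fun (map_sub nuL (μ : Fin 5 → Fin 5 → ℂ) μ') π
          simpa [nuL_apply] using this
        rw [hlin, h' π, sub_self]
    ext1
    exact sub_eq_zero.1 hz
  have h1 : Module.finrank ℂ W ≤ Module.finrank ℂ (LinearMap.ker (oblL α β γ)) :=
    LinearMap.finrank_le_finrank_of_injective hf
  -- (3) the kernel is a proper subspace of the 10-dimensional leaf space
  have hne_top : LinearMap.ker (oblL α β γ) ≠ ⊤ := by
    intro htop
    have hm : (Pi.single π₀ (1 : ℂ) : P → ℂ) ∈ LinearMap.ker (oblL α β γ) := by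
      rw [htop]; exact Submodule.mem_top
    rw [LinearMap.mem_ker, oblL_single] at hm
    exact hne hm
  have h2 := Submodule.finrank_lt hne_top
  rw [Module.finrank_fintype_fun_eq_card, card_P] at h2
  omega

/- Remark (bookkeeping, not typed here): for the leaf pair `π = (s,t)` and the complementary letters `p,q,r`,
`obl α β γ π = per3 α β γ p q r` (both are `Σ` over the six orderings of `{p,q,r}` of `α_• β_• γ_•`), so the hypothesis
`obl α β γ π₀ ≠ 0` of `finrank_le_nine_of_witness` is the «non-zero 3 × 3 sub-permanent» of `RankOneWitness45`. -/

/-- TWO WITNESSES ⇒ cap ≤ 8 (the (4,4) interface).  Two pairwise-isotropic triples whose obligation-coordinate vectors are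
linearly independent (a non-zero `2 × 2` minor at leaf pairs `π₁, π₂`) cap every captured symmetric zero-diagonal `W` at 8. -/
theorem finrank_le_eight_of_two_witnesses (U01 U02 U12 W : Submodule ℂ (Fin 5 → Fin 5 → ℂ))
    (hWs : ∀ μ ∈ W, ∀ s t : Fin 5, μ s t = μ t s) (hWd : ∀ μ ∈ W, ∀ s : Fin 5, μ s s = 0)
    (hWc : ∀ μ ∈ W, contractZ μ ∈ L3 U01 U02 U12) (α₁ β₁ γ₁ α₂ β₂ γ₂ : Fin 5 → ℂ)
    (h01₁ : ∀ u ∈ U01, ∑ p : Fin 5, ∑ q : Fin 5, u p q * (α₁ p * β₁ q) = 0)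
    (h02₁ : ∀ u ∈ U02, ∑ p : Fin 5, ∑ r : Fin 5, u p r * (α₁ p * γ₁ r) = 0)
    (h12₁ : ∀ u ∈ U12, ∑ q : Fin 5, ∑ r : Fin 5, u q r * (β₁ q * γ₁ r) = 0)
    (h01₂ : ∀ u ∈ U01, ∑ p : Fin 5, ∑ q : Fin 5, u p q * (α₂ p * β₂ q) = 0)
    (h02₂ : ∀ u ∈ U02, ∑ p : Fin 5, ∑ r : Fin 5, u p r * (α₂ p * γ₂ r) = 0)
    (h12₂ : ∀ u ∈ U12, ∑ q : Fin 5, ∑ r : Fin 5, u q r * (β₂ q * γ₂ r) = 0)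
    (π₁ π₂ : P)
    (hD : obl α₁ β₁ γ₁ π₁ * obl α₂ β₂ γ₂ π₂ - obl α₁ β₁ γ₁ π₂ * obl α₂ β₂ γ₂ π₁ ≠ 0) :
    Module.finrank ℂ W ≤ 8 := by
  classical
  set θ : (P → ℂ) →ₗ[ℂ] ℂ × ℂ := (oblL α₁ β₁ γ₁).prod (oblL α₂ β₂ γ₂) with hθ
  have key : ∀ x, θ x = (oblL α₁ β₁ γ₁ x, oblL α₂ β₂ γ₂ x) := fun x => by rw [hθ]; rfl
  -- (1) `ν(W) ⊆ ker θ`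
  have hker : ∀ μ ∈ W, nuL μ ∈ LinearMap.ker θ := by
    intro μ hμ
    rw [LinearMap.mem_ker, key, Prod.mk_eq_zero, ← tripleEval_contractZ, ← tripleEval_contractZ]
    exact ⟨witness_annihilates U01 U02 U12 α₁ β₁ γ₁ h01₁ h02₁ h12₁ μ (hWc μ hμ),
      witness_annihilates U01 U02 U12 α₂ β₂ γ₂ h01₂ h02₂ h12₂ μ (hWc μ hμ)⟩
  -- (2) injective co-restriction
  let f : W →ₗ[ℂ] LinearMap.ker θ :=
    LinearMap.codRestrict (LinearMap.ker θ) (nuL.comp W.subtype) (fun μ => hker μ μ.2)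
  have hf : Function.Injective f := by
    intro μ μ' h
    have h' : ∀ π, nu (μ : Fin 5 → Fin 5 → ℂ) π = nu (μ' : Fin 5 → Fin 5 → ℂ) π := by
      intro π
      have := congr_fun (congrArg Subtype.val h) π
      simpa [f, nuL_apply] using this
    have hz : ((μ : Fin 5 → Fin 5 → ℂ) - (μ' : Fin 5 → Fin 5 → ℂ)) = 0 := by
      refine eq_zero_of_nu _ ?_ ?_ ?_
      · intro s t
        simp only [Pi.sub_apply]
        rw [hWs _ μ.2 s t, hWs _ μ'.2 s t]
      · intro s
        simp only [Pi.sub_apply]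
        rw [hWd _ μ.2 s, hWd _ μ'.2 s, sub_zero]
      · intro π
        have hlin : nu ((μ : Fin 5 → Fin 5 → ℂ) - μ') π
            = nu (μ : Fin 5 → Fin 5 → ℂ) π - nu (μ' : Fin 5 → Fin 5 → ℂ) π := by
          have := congr_fun (map_sub nuL (μ : Fin 5 → Fin 5 → ℂ) μ') π
          simpa [nuL_apply] using this
        rw [hlin, h' π, sub_self]
    ext1
    exact sub_eq_zero.1 hz
  have h1 : Module.finrank ℂ W ≤ Module.finrank ℂ (LinearMap.ker θ) :=
    LinearMap.finrank_le_finrank_of_injective hf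
  -- (3) `range θ` contains two independent vectors, so `finrank (range θ) ≥ 2`
  let v : Fin 2 → (ℂ × ℂ) := ![θ (Pi.single π₁ 1), θ (Pi.single π₂ 1)]
  have hv1 : θ (Pi.single π₁ 1) = (obl α₁ β₁ γ₁ π₁, obl α₂ β₂ γ₂ π₁) := by
    rw [key, oblL_single, oblL_single]
  have hv2 : θ (Pi.single π₂ 1) = (obl α₁ β₁ γ₁ π₂, obl α₂ β₂ γ₂ π₂) := by
    rw [key, oblL_single, oblL_single]
  have hli : LinearIndependent ℂ v := by
    rw [LinearIndependent.pair_iff]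
    intro s t hst
    rw [hv1, hv2] at hst
    have e1 := congrArg Prod.fst hst
    have e2 := congrArg Prod.snd hst
    simp only [Prod.fst_add, Prod.snd_add, Prod.smul_mk, smul_eq_mul, Prod.fst_zero, Prod.snd_zero] at e1 e2
    have hs : s * (obl α₁ β₁ γ₁ π₁ * obl α₂ β₂ γ₂ π₂ - obl α₁ β₁ γ₁ π₂ * obl α₂ β₂ γ₂ π₁) = 0 := by
      linear_combination (obl α₂ β₂ γ₂ π₂) * e1 - (obl α₁ β₁ γ₁ π₂) * e2
    have ht : t * (obl α₁ β₁ γ₁ π₁ * obl α₂ β₂ γ₂ π₂ - obl α₁ β₁ γ₁ π₂ * obl α₂ β₂ γ₂ π₁) = 0 := by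
      linear_combination (obl α₁ β₁ γ₁ π₁) * e2 - (obl α₂ β₂ γ₂ π₁) * e1
    exact ⟨(mul_eq_zero.1 hs).resolve_right hD, (mul_eq_zero.1 ht).resolve_right hD⟩
  have hspan : Submodule.span ℂ (Set.range v) ≤ LinearMap.range θ := by
    rw [Submodule.span_le]
    rintro _ ⟨i, rfl⟩
    fin_cases i <;> simp [v, LinearMap.mem_range_self]
  have h2 : 2 ≤ Module.finrank ℂ (LinearMap.range θ) := by
    have := Submodule.finrank_mono hspan
    rwa [finrank_span_eq_card hli, Fintype.card_fin] at this
  -- (4) rank–nullity in the 10-dimensional leaf space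
  have hrn := LinearMap.finrank_range_add_finrank_ker θ
  rw [Module.finrank_fintype_fun_eq_card, card_P] at hrn
  omega



/-! ## r6.2 (2026-08-29): the explicit witness behind the leaf closures L7 / L9 and the Π-quadric Λ-argument of memo 2 §10.7–10.9.
If at some `α` the columns `s, t` of EVERY form on both sides vanish (`Σ_p α_p u(p,s) = Σ_p α_p u(p,t) = 0`) and `α` has a non-zero letter
`y ∉ {s,t}`, then `(α, x_s + x_t, x_s + x_t)` is pairwise isotropic with `per3 = 2 α_y ≠ 0` on `{y,s,t}` — a rank-one witness, so `cap ≤ 9`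
(`finrank_le_nine_of_witness`).  In the memo this is applied on the linear spaces `Λ = {a·α = b·α = 0}` (L7), `Λ_H = {φ_s = φ_t = h = 0}` (L9)
and `{a_i = b_i = 0}` (Π-coupled sides): VIOL forces each such space into `ℓ = ⟨x_s, x_t⟩`. -/
theorem witness_of_vanishing_columns {m₁ m₂ : ℕ} (u₁ : Fin m₁ → Fin 5 → Fin 5 → ℂ) (u₂ : Fin m₂ → Fin 5 → Fin 5 → ℂ)
    (α : Fin 5 → ℂ) (s t y : Fin 5) (hst : s ≠ t) (hys : y ≠ s) (hyt : y ≠ t) (hy : α y ≠ 0)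
    (h₁s : ∀ i, ∑ p : Fin 5, α p * u₁ i p s = 0) (h₁t : ∀ i, ∑ p : Fin 5, α p * u₁ i p t = 0)
    (h₂s : ∀ j, ∑ p : Fin 5, α p * u₂ j p s = 0) (h₂t : ∀ j, ∑ p : Fin 5, α p * u₂ j p t = 0) :
    ∃ β γ : Fin 5 → ℂ,
      (∀ i, ∑ p : Fin 5, ∑ q : Fin 5, u₁ i p q * (α p * β q) = 0) ∧
      (∀ j, ∑ p : Fin 5, ∑ r : Fin 5, u₂ j p r * (α p * γ r) = 0) ∧
      ∃ p q r : Fin 5, p ≠ q ∧ p ≠ r ∧ q ≠ r ∧ per3 α β γ p q r ≠ 0 := by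
  classical
  have hts : t ≠ s := fun h => hst h.symm
  -- δ = x_s + x_t
  let δ : Fin 5 → ℂ := fun q => (if q = s then 1 else 0) + (if q = t then 1 else 0)
  have hδs : δ s = 1 := by simp [δ, hst]
  have hδt : δ t = 1 := by simp [δ, hts]
  have hδy : δ y = 0 := by simp [δ, hys, hyt]
  -- contraction of a form with (α, δ): Σ_p Σ_q u p q α_p δ_q = Σ_p α_p u p s + Σ_p α_p u p t
  have key : ∀ u : Fin 5 → Fin 5 → ℂ,
      ∑ p : Fin 5, ∑ q : Fin 5, u p q * (α p * δ q) = (∑ p : Fin 5, α p * u p s) + ∑ p : Fin 5, α p * u p t := by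
    intro u
    rw [← Finset.sum_add_distrib]
    refine Finset.sum_congr rfl fun p _ => ?_
    have : ∀ q, u p q * (α p * δ q) = (if q = s then α p * u p s else 0) + (if q = t then α p * u p t else 0) := by
      intro q
      by_cases hqs : q = s
      · subst hqs; simp [δ, hst]; ring
      · by_cases hqt : q = t
        · subst hqt; simp [δ, hts]; ring
        · simp [δ, hqs, hqt]
    simp_rw [this]
    rw [Finset.sum_add_distrib, Finset.sum_ite_eq' Finset.univ s, Finset.sum_ite_eq' Finset.univ t]
    simp
  refine ⟨δ, δ, fun i => ?_, fun j => ?_, y, s, t, hys, hyt, hst, ?_⟩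
  · rw [key, h₁s i, h₁t i, add_zero]
  · rw [key, h₂s j, h₂t j, add_zero]
  · simp only [per3, hδs, hδt, hδy]
    norm_num [hy]

end Summit.ValiantsHypothesis.ValiantsHypothesis.Cruxes.LaplaceOptimalFive.SeparatedCapture
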